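import Summits.Ventures.PackingBounds.ThreePointCert.K5d14LeafM1
import Summits.Ventures.PackingBounds.ThreePointCert.K5d14LeafM2
import Summits.Ventures.PackingBounds.ThreePointCert.K5d14LeafM3
import Summits.Ventures.PackingBounds.ThreePointCert.K5d14LeafM4

/-!
# κ(5) ≤ 44: decoded intermediate polynomials of the split check of (ii')

Framing: lottery ticket; floor = certified bounds/negative ranges. Venture `PackingBounds` (cell
`pub-packcert`), three-point SDP family. Integer data / kernel checks of the Bachoc–Vallentin certificate (n = 5,
s = 1/2, degree d = 14, multiplier set = cell mode sym2; exact certificate `sdp-d5-deg14-sym2-lp-v1.json`, cert2lean_s2.py S = 52)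
for the SPLIT check of `(ii')` (`ThreePointCert.CheckSym2Split`: intermediate polynomials `M`, `M'` as data; lp gen 8).
Generated file.
-/

namespace Summit.Ventures.PackingBounds.ThreePointCert.K5d14

open Literature.Geometry.DiscreteGeometry Literature.Geometry.DiscreteGeometry.PolyCert PolyCert.SPoly

/-- `M = target − E₀ − [g_qE₁ + (g_qE₁)(v,u,t) + (g_qE₁)(t,v,u)]` (decoded term list). -/
def polyM : SPoly := ofFlat pMf0 ++ ofFlat pMf1 ++ ofFlat pMf2 ++ ofFlat pMf3 ++ ofFlat pMf4 ++ ofFlat pMf5 ++ ofFlat pMf6 ++ ofFlat pMf7 ++ ofFlat pMf8 ++ ofFlat pMf9 ++ ofFlat pMf10 ++ ofFlat pMf11 ++ ofFlat pMf12 ++ ofFlat pMf13 ++ ofFlat pMf14 ++ ofFlat pMf15 ++ ofFlat pMf16 ++ ofFlat pMf17 ++ ofFlat pMf18 ++ ofFlat pMf19 ++ ofFlat pMf20 ++ ofFlat pMf21 ++ ofFlat pMf22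

/-- `M' = M − m₂E₂` (decoded term list). -/
def polyMM : SPoly := ofFlat pMMf0 ++ ofFlat pMMf1 ++ ofFlat pMMf2 ++ ofFlat pMMf3 ++ ofFlat pMMf4 ++ ofFlat pMMf5 ++ ofFlat pMMf6 ++ ofFlat pMMf7 ++ ofFlat pMMf8 ++ ofFlat pMMf9 ++ ofFlat pMMf10 ++ ofFlat pMMf11 ++ ofFlat pMMf12 ++ ofFlat pMMf13 ++ ofFlat pMMf14 ++ ofFlat pMMf15 ++ ofFlat pMMf16 ++ ofFlat pMMf17 ++ ofFlat pMMf18 ++ ofFlat pMMf19 ++ ofFlat pMMf20 ++ ofFlat pMMf21 ++ ofFlat pMMf22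

end Summit.Ventures.PackingBounds.ThreePointCert.K5d14
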